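import Summits.QuantumFields.YangMills.Theorems.FlatTubeReductionDecimationClassify
import Summits.QuantumFields.YangMills.Theorems.FlatTubeReductionDecimationTrivialDecoders
import Summits.QuantumFields.YangMills.Theorems.FlatTubeReductionDecimationIdentity
import Summits.QuantumFields.YangMills.Theorems.FlatTubeReductionDecimationTranslate
import HarnessLib

/-!
# Route `FlatTubeReduction`, crux `PinnedUnitStepEx` (stmt-QuantumFields-27561), stub `stub_smearVarPosGS1` — E2d-2b: auxiliary facts for the assembly

Seat ym-line-fcl-p3 g9 (2026-08-28).  Blueprint v2 §E2 (d):
* `pullback_ae_eq_zero_iff` — `h ∘ thin L' ∘ τ_v = 0` a.e. iff `h = 0` a.e. (both maps preserve the a-priori measures);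
* `exists_normalForm` — every coarse link set has a translate in normal form in every direction with `0 < mrun_j < L'`;
* `decoder_step_data` — for a trivial decoder component `v_k = −m` (`m ≤ ℓ_k`) of a normal-form `R₁`, the two readings of a coarse site agree or are
  joined by one step inside the fine run (the hypothesis of the translate lemma `decoded_eq_shiftLinks`);
* `polyakov_structure` — if every `j`-slice of `R₁` is contractible then all links of `R₁` have direction `j` and `R₁` is invariant under `e_j`.
R2b1 RECORD rung; no summit/crux/stub here.
-/

set_option autoImplicit false

noncomputable section

namespace Summit.QuantumFields.YangMills.Theorems.FlatTubeReduction.Decimation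

open MeasureTheory Finset Function
open Literature.MathematicalPhysics.QuantumFieldTheory (Site Edge GaugeConfig haarProbability)
open Literature.MathematicalPhysics.QuantumFieldTheory.TorusTranslation
open Summit.QuantumFields.YangMills.Theorems.FemtoCutoffLadder.Thinning
open Summit.QuantumFields.YangMills.Theorems.FemtoTransferGap (configMeasure)
open Literature.Probability.Independence.Hoeffding

variable {L' : ℕ} [NeZero L']

section Measure

variable {G : Type*} [Group G] [MeasurableSpace G] [TopologicalSpace G] [IsTopologicalGroup G] [CompactSpace G] [BorelSpace G]
  [T2Space G] [SecondCountableTopology G]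

/-- **Pull-back along the decimation preserves and reflects a.e.-nullity** (bounded measurable `h`). [folklore] -/
theorem pullback_ae_eq_zero_iff {h : GaugeConfig 3 L' G → ℝ} (hm : Measurable h) {C : ℝ} (hC : ∀ W, |h W| ≤ C) (v : Site 3 (L' + 1)) :
    (fun U : GaugeConfig 3 (L' + 1) G => h (thin L' (torusConfigShift v U))) =ᵐ[configMeasure G (L' + 1)] 0 ↔
      h =ᵐ[configMeasure G L'] 0 := by
  have habs : Measurable fun W => |h W| := hm.abs
  have hint : ∫ U, |h (thin L' (torusConfigShift v U))| ∂configMeasure G (L' + 1) = ∫ W, |h W| ∂configMeasure G L' := by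
    have h1 := Summit.QuantumFields.YangMills.Theorems.FemtoTransferGap.integral_comp_torusConfigShift (G := G) v
      (fun U : GaugeConfig 3 (L' + 1) G => |h (thin L' U)|)
    rw [h1]
    exact integral_comp_thin (Nat.le_succ L') habs
  have hi1 : Integrable (fun W => |h W|) (configMeasure G L') :=
    Integrable.mono' (integrable_const C) habs.aestronglyMeasurable (Filter.Eventually.of_forall fun W => by
      rw [Real.norm_eq_abs, abs_abs]; exact hC W)
  have hm2 : Measurable fun U : GaugeConfig 3 (L' + 1) G => |h (thin L' (torusConfigShift v U))| :=
    habs.comp (measurable_thin_shift v)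
  have hi2 : Integrable (fun U : GaugeConfig 3 (L' + 1) G => |h (thin L' (torusConfigShift v U))|) (configMeasure G (L' + 1)) :=
    Integrable.mono' (integrable_const C) hm2.aestronglyMeasurable (Filter.Eventually.of_forall fun U => by
      rw [Real.norm_eq_abs, abs_abs]; exact hC _)
  constructor
  · intro h0
    have hz : ∫ U, |h (thin L' (torusConfigShift v U))| ∂configMeasure G (L' + 1) = 0 := by
      rw [integral_congr_ae (g := fun _ => (0 : ℝ)) (h0.mono fun U hU => by
        have hU' : h (thin L' (torusConfigShift v U)) = 0 := hU
        change |h (thin L' (torusConfigShift v U))| = (0 : ℝ)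
        rw [hU', abs_zero])]
      simp
    rw [hint] at hz
    exact ((integral_eq_zero_iff_of_nonneg (fun W => abs_nonneg _) hi1).1 hz).mono fun W hW => by simpa using hW
  · intro h0
    have hz : ∫ W, |h W| ∂configMeasure G L' = 0 := by
      rw [integral_congr_ae (g := fun _ => (0 : ℝ)) (h0.mono fun W hW => by
        have hW' : h W = 0 := hW
        change |h W| = (0 : ℝ)
        rw [hW', abs_zero])]
      simp
    rw [← hint] at hz
    exact ((integral_eq_zero_iff_of_nonneg (fun U => abs_nonneg _) hi2).1 hz).mono fun U hU => by simpa using hU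

end Measure

/-! ## Normal form in all directions -/

omit [NeZero L'] in
/-- **Normal form**: a translate of `R` such that in every direction `j` with `0 < mrun_j R < L'` the slices `1, …, ℓ_j` are contractible and the
slice `0` is not. [folklore] -/
theorem exists_normalForm (R : Finset (Edge 3 L')) : ∃ w : Site 3 L', ∀ j : Fin 3, 0 < mrun j R → mrun j R < L' →
    (∀ i : ℕ, i < mrun j R → IsContr j (1 + (i : ZMod L')) (shiftLinks w R)) ∧ ¬ IsContr j 0 (shiftLinks w R) := by
  have hdir : ∀ j : Fin 3, ∃ wj : Site 3 L', (∀ k, k ≠ j → wj k = 0) ∧ (mrun j R < L' →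
      (∀ i : ℕ, i < mrun j R → IsContr j (1 + (i : ZMod L')) (shiftLinks wj R)) ∧ ¬ IsContr j 0 (shiftLinks wj R)) := by
    intro j
    by_cases hM : mrun j R < L'
    · obtain ⟨w, hw, hrun, h0⟩ := exists_shift_normalForm_dir j R hM
      exact ⟨w, hw, fun _ => ⟨hrun, h0⟩⟩
    · exact ⟨0, fun _ _ => rfl, fun h => absurd h hM⟩
  choose wf hwf using hdir
  refine ⟨fun k => wf k k, fun j _ hM => ?_⟩
  obtain ⟨hrun, h0⟩ := (hwf j).2 hM
  have key : ∀ a : ZMod L', IsContr j a (shiftLinks (fun k => wf k k) R) ↔ IsContr j a (shiftLinks (wf j) R) := by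
    intro a
    rw [isContr_shiftLinks_iff, isContr_shiftLinks_iff]
  exact ⟨fun i hi => (key _).2 (hrun i hi), fun h => h0 ((key 0).1 h)⟩

/-! ## Data of trivial decoder components -/

/-- **Step data of a trivial decoder component.**  In normal form in direction `k` (fine run `1, …, ℓ+1` of `fineSupp 0 R₁` contractible, via
`fine_run_of_normalForm`), for `v_k = −m`, `m ≤ ℓ < L'`, the reading `ι(x_k) − v_k = ι(x_k) + m` of the decoder and the reading `ι(x_k + m)` of
the translate either coincide or differ by one upward step inside the fine run. [folklore] -/
theorem decoder_step_data {R₁ : Finset (Edge 3 L')} {k : Fin 3} {ℓ m : ℕ} (hℓ : ℓ < L') (hm : m ≤ ℓ)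
    (hrun : ∀ i : ℕ, i < ℓ → IsContr k (1 + (i : ZMod L')) R₁) (a : ZMod L') :
    ∃ n : ℕ, thinCoord (L' + 1) L' (a + (m : ZMod L')) = thinCoord (L' + 1) L' a + (m : ZMod (L' + 1)) + (n : ZMod (L' + 1)) ∧
      ∀ t : ℕ, t ≤ n → 0 < n → IsContr k (thinCoord (L' + 1) L' a + (m : ZMod (L' + 1)) + (t : ZMod (L' + 1))) (fineSupp (L' + 1) 0 R₁) := by
  classical
  by_cases hz : ∃ i₀ : ℕ, i₀ < m ∧ a + (i₀ : ZMod L') = 0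
  · -- take the first zero
    let P : ℕ → Prop := fun i => i < m ∧ a + (i : ZMod L') = 0
    have hP : ∃ i, P i := hz
    set i₀ := Nat.find hP with hi₀def
    have hi₀ : i₀ < m ∧ a + (i₀ : ZMod L') = 0 := Nat.find_spec hP
    have hmin : ∀ i' : ℕ, i' < i₀ → a + (i' : ZMod L') ≠ 0 := fun i' hi' h' =>
      Nat.find_min hP hi' ⟨lt_trans hi' hi₀.1, h'⟩
    have hca : thinCoord (L' + 1) L' a = -((i₀ : ℕ) : ZMod (L' + 1)) := by
      have h1 := thinCoord_add_nat_of_ne_zero a i₀ hmin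
      rw [hi₀.2, (thinCoord_eq_zero_iff (Nat.le_succ L') 0).2 rfl] at h1
      exact eq_neg_of_add_eq_zero_left h1.symm
    refine ⟨1, ?_, fun t ht _ => ?_⟩
    · rw [thinCoord_add_nat_of_eq_zero a hi₀.1 (by omega) hi₀.2, Nat.cast_one]
    · -- the fine coordinate `m − i₀ + t ∈ {1, …, ℓ+1}`
      have hfine := fine_run_of_normalForm (R := R₁) (j := k) hℓ hrun (m - i₀ - 1 + t) (by omega)
      rw [hca]
      have hcast : ((m - i₀ - 1 + t : ℕ) : ZMod (L' + 1)) = (m : ZMod (L' + 1)) - (i₀ : ZMod (L' + 1)) - 1 + (t : ZMod (L' + 1)) := by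
        have hsub : i₀ + 1 ≤ m := by omega
        obtain ⟨r, hr⟩ := Nat.exists_eq_add_of_le hsub
        rw [hr, show i₀ + 1 + r - i₀ - 1 + t = r + t by omega]
        push_cast
        ring
      have hre : -((i₀ : ℕ) : ZMod (L' + 1)) + (m : ZMod (L' + 1)) + (t : ZMod (L' + 1)) = 1 + ((m - i₀ - 1 + t : ℕ) : ZMod (L' + 1)) := by
        rw [hcast]; ring
      rw [hre]
      exact hfine
  · push Not at hz
    refine ⟨0, ?_, fun t _ h0 => absurd h0 (lt_irrefl 0)⟩
    rw [thinCoord_add_nat_of_ne_zero a m (fun i' hi' => hz i' hi'), Nat.cast_zero, add_zero]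

omit [NeZero L'] in
/-- **Polyakov structure**: if every `j`-slice of `R₁` is contractible then all links of `R₁` have direction `j` and `R₁ + e_j = R₁`. [folklore] -/
theorem polyakov_structure {R₁ : Finset (Edge 3 L')} {j : Fin 3} (hall : ∀ a : ZMod L', IsContr j a R₁) :
    (∀ e ∈ R₁, e.2 = j) ∧ shiftLinks (Pi.single j (1 : ZMod L') : Site 3 L') R₁ = R₁ := by
  have hdir : ∀ e ∈ R₁, e.2 = j := fun e he => (hall (e.1 j)).1 e he rfl
  refine ⟨hdir, ?_⟩
  ext ⟨y, i⟩
  rw [mem_shiftLinks_iff]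
  by_cases hij : i = j
  · subst hij
    exact (hall (y i)).2 y rfl
  · constructor
    · intro h; exact absurd (hdir _ h) hij
    · intro h; exact absurd (hdir _ h) hij

end Summit.QuantumFields.YangMills.Theorems.FlatTubeReduction.Decimation
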